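import Literature.Geometry.Riemannian.HuiskenMonotonicity
import Literature.Geometry.Riemannian.EmbeddedSubmanifoldHausdorff
import Literature.Geometry.Riemannian.ColdingMinicozziEntropy
import Literature.Geometry.Riemannian.ColdingMinicozziEntropyAreaRatio
import HarnessLib

/-!
# The Colding–Minicozzi entropy is non-increasing along a classical mean curvature flow

Topic `Literature/Geometry/Riemannian`. Huisken's monotonicity formula (`HuiskenMonotonicity.lean`)
in the vocabulary of `ColdingMinicozziEntropy.lean` (the `F`-functional `gaussianArea` and the
entropy `gaussianEntropy` of a subset of `ℝⁿ⁺¹`, with the Euclidean Hausdorff measure `μHE[n]`):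
for a classical mean curvature flow `(F, ν)` of a compact `n`-manifold `N` in `ℝⁿ⁺¹` on `[a, b]`
(embedded slices `M_t = F_t(N)`),

* `IsClassicalMCF.gaussianArea_image_eq` — `F_{x₀,τ}(M_t) = (4πτ)^{-n/2} ∫_N e^{-‖F_t - x₀‖²/4τ} dμ_t`
  (the area measure of the embedded slice is `𝓗ⁿ ⌊ M_t`, `EmbeddedSubmanifoldHausdorff.lean`);
* `IsClassicalMCF.gaussianArea_image_le` — **`F_{x₀,t₀}(M_t) ≤ F_{x₀,t₀+(t-s)}(M_s)`** for
  `a < s ≤ t < b`, `t₀ > 0` (Colding–Minicozzi 2012, (1.9));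
* `IsClassicalMCF.gaussianEntropy_image_le` — **`λ(M_t) ≤ λ(M_s)`** for `a < s ≤ t < b`
  (Colding–Minicozzi 2012, Lemma 1.11: the entropy is non-increasing under mean curvature flow);
* `IsClassicalMCF.restrict` — restriction of a classical flow to a subinterval;
* (closed interval) `IsClassicalMCF.continuousOn_integral_mul_density` — continuity of
  `t ↦ ∫ f(t,·) θ_t dμ_{t₀}` on `[a, b]` (dominated convergence);
  `IsClassicalMCF.antitoneOn_gaussianIntegral_Icc` — Huisken's monotonicity on `[a, b]` (`T > b`);
  `IsClassicalMCF.gaussianArea_image_le_of_le`, `IsClassicalMCF.gaussianEntropy_image_le_of_le`,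
  `IsClassicalMCF.gaussianEntropy_image_le_initial` — **`λ(M_t) ≤ λ(M_a)` for all `t ∈ [a, b)`**:
  the entropy never exceeds that of the initial hypersurface;
* `IsClassicalMCF.antitoneOn_gaussianArea_image`, `IsClassicalMCF.tendsto_gaussianArea_image`,
  `IsClassicalMCF.gaussianDensity_le_gaussianEntropy` — `t ↦ F_{x₀,T-t}(M_t)` is non-increasing on
  `(a, T)` (`T ≤ b`), so **Huisken's Gaussian density `Θ(x₀, T) = lim_{t↑T} F_{x₀,T-t}(M_t)`
  exists** (the infimum) and `Θ(x₀, T) ≤ λ(M_s) ≤ λ(M_a)`;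
* `IsClassicalMCF.hausdorffMeasure_image_eq`, `IsClassicalMCF.hausdorffMeasure_image_le` —
  `𝓗ⁿ(M_t) = ∫ θ_t dμ_r` and **`𝓗ⁿ(M_t) ≤ 𝓗ⁿ(M_s)` for `a ≤ s ≤ t ≤ b`**: the area of a
  hypersurface moving by mean curvature is non-increasing (Huisken 1984, §3);
* `IsClassicalMCF.gaussianArea_image_le_gaussianEntropy_initial`,
  `IsClassicalMCF.measure_inter_closedBall_image_le`, `IsClassicalMCF.hausdorffMeasure_image_le_initial`
  — uniform bounds along the flow from the initial entropy / area: `F_{x₀,t₀}(M_t) ≤ λ(M_a)`,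
  **`𝓗ⁿ(M_t ∩ B̄_R(p)) ≤ e^{1/4}(4π)^{n/2} Rⁿ λ(M_a)`** (uniform area ratios), `𝓗ⁿ(M_t) ≤ 𝓗ⁿ(M_a)`.

Everything is PROVED; no definitions, no named facts.

## References

* T. H. Colding, W. P. Minicozzi II, *Generic mean curvature flow I; generic singularities*,
  Ann. of Math. 175 (2012), (0.5), (1.9), Lemma 1.11. [ColdingMinicozzi2012]
* G. Huisken, J. Differential Geom. 31 (1990), Thm. 3.1. [Huisken1990]
-/

noncomputable section

open Bundle Set Function Filter MeasureTheory Module Metric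
open scoped Manifold ContDiff Topology RealInnerProductSpace ENNReal Matrix

namespace Literature.Geometry.Riemannian

open Lorentzian Lorentzian.PseudoRiemannianMetric EuclideanHypersurface

section EntropyMonotonicity

variable {n : ℕ} {N : Type*} [TopologicalSpace N] [ChartedSpace (EuclideanSpace ℝ (Fin n)) N]
  [IsManifold (𝓡 n) ∞ N]
  {F : ℝ → N → EuclideanSpace ℝ (Fin (n + 1))}
  {ν : (t : ℝ) → NormalField (𝓡 (n + 1)) (F t)} {a b : ℝ}

/-- **Restriction of a classical mean curvature flow to a subinterval.** [folklore] -/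
theorem IsClassicalMCF.restrict
    (h : IsClassicalMCF (euclideanMetric (EuclideanSpace ℝ (Fin (n + 1)))) F ν a b) {a' b' : ℝ}
    (ha : a ≤ a') (hb : b' ≤ b) :
    IsClassicalMCF (euclideanMetric (EuclideanSpace ℝ (Fin (n + 1)))) F ν a' b' := by
  have hsub : Icc a' b' ⊆ Icc a b := Icc_subset_Icc ha hb
  obtain ⟨U, hU, hIU, hF⟩ := h.contMDiffOn
  exact
    { compactSpace := h.compactSpace
      contMDiffOn := ⟨U, hU, hsub.trans hIU, hF⟩
      isSpacelikeImmersion := fun t ht ↦ h.isSpacelikeImmersion t (hsub ht)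
      injective := fun t ht ↦ h.injective t (hsub ht)
      isUnitNormal := fun t ht ↦ h.isUnitNormal t (hsub ht)
      contMDiff_normal := fun t ht ↦ h.contMDiff_normal t (hsub ht)
      velocity_eq := fun t ht y ↦ h.velocity_eq t (hsub ht) y }

variable [CompactSpace N] [T2Space N] [MeasurableSpace N] [BorelSpace N]

/-- **The Gaussian area of the moving hypersurface is the Gaussian integral**: for `t ∈ [a, b]`
and `τ > 0`, `F_{x₀,τ}(F_t(N)) = (4πτ)^{-n/2} ∫_N e^{-‖F_t - x₀‖²/4τ} dμ_t` (in `[0, ∞]`;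
`gaussianArea` of `ColdingMinicozziEntropy.lean` and the area measure of the embedded slice,
`lintegral_comp_riemannianMeasure_induced`). [cite: ColdingMinicozzi2012, (0.5)] -/
theorem IsClassicalMCF.gaussianArea_image_eq
    (h : IsClassicalMCF (euclideanMetric (EuclideanSpace ℝ (Fin (n + 1)))) F ν a b) {t : ℝ}
    (ht : t ∈ Icc a b) (x₀ : EuclideanSpace ℝ (Fin (n + 1))) {τ : ℝ} (hτ : 0 < τ) :
    gaussianArea n x₀ τ (F t '' univ) = ENNReal.ofReal (∫ w, (4 * Real.pi * τ) ^ (-(n : ℝ) / 2) *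
        Real.exp (-‖F t w - x₀‖ ^ 2 / (4 * τ))
      ∂riemannianMeasure ((euclideanMetric (EuclideanSpace ℝ (Fin (n + 1)))).inducedRiemannianMetric
        (F t) contMDiff_pullbackBilin_holds (h.isSpacelikeImmersion t ht))) := by
  have hsp := h.isSpacelikeImmersion t ht
  have hinj := h.injective t ht
  set μ := riemannianMeasure ((euclideanMetric (EuclideanSpace ℝ (Fin (n + 1)))).inducedRiemannianMetric
    (F t) contMDiff_pullbackBilin_holds hsp) with hμ
  haveI : IsFiniteMeasure μ := isFiniteMeasure_riemannianMeasure _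
  have hcont : Continuous fun w ↦ Real.exp (-‖F t w - x₀‖ ^ 2 / (4 * τ)) :=
    ((((hsp.contMDiff.continuous).sub continuous_const).norm.pow 2).neg.div_const _).rexp
  have hint : Integrable (fun w ↦ Real.exp (-‖F t w - x₀‖ ^ 2 / (4 * τ))) μ :=
    integrable_of_continuous (h := (euclideanMetric (EuclideanSpace ℝ (Fin (n + 1)))).inducedRiemannianMetric
      (F t) contMDiff_pullbackBilin_holds hsp) hcont
  rw [image_univ, gaussianArea, gaussianMass, gaussianNormalization,
    ← lintegral_comp_riemannianMeasure_induced hsp hinj (gaussianWeight x₀ τ)]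
  simp only [gaussianWeight]
  rw [integral_const_mul, ENNReal.ofReal_mul (Real.rpow_nonneg (by positivity) _),
    ofReal_integral_eq_lintegral_ofReal hint (Eventually.of_forall fun w ↦ (Real.exp_pos _).le)]


/-- **Huisken's monotonicity in the Colding–Minicozzi `F`-functional** (Colding–Minicozzi 2012,
(1.9): "Huisken's monotonicity formula … gives that `F_{x₀,t₀}(M_t)` is non-increasing …"): for a
classical mean curvature flow and `a < s ≤ t < b`, `t₀ > 0`,
`F_{x₀,t₀}(F_t(N)) ≤ F_{x₀, t₀ + (t - s)}(F_s(N))`. [cite: ColdingMinicozzi2012, (1.9)]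
[cite: Huisken1990, Thm. 3.1] -/
theorem IsClassicalMCF.gaussianArea_image_le
    (h : IsClassicalMCF (euclideanMetric (EuclideanSpace ℝ (Fin (n + 1)))) F ν a b) {s t : ℝ}
    (hs : s ∈ Ioo a b) (ht : t ∈ Ioo a b) (hst : s ≤ t) (x₀ : EuclideanSpace ℝ (Fin (n + 1)))
    {t₀ : ℝ} (ht₀ : 0 < t₀) :
    gaussianArea n x₀ t₀ (F t '' univ) ≤ gaussianArea n x₀ (t₀ + (t - s)) (F s '' univ) := by
  -- restrict the flow to `[a, b']`, `b' = min b (t + t₀)`, and use `T = t + t₀ ≥ b'`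
  set T : ℝ := t + t₀ with hT
  set b' : ℝ := min b T with hb'
  have htb' : t < b' := lt_min ht.2 (by linarith)
  have h' := h.restrict le_rfl (min_le_left b T : b' ≤ b)
  have hs' : s ∈ Ioo a b' := ⟨hs.1, lt_of_le_of_lt hst htb'⟩
  have ht' : t ∈ Ioo a b' := ⟨ht.1, htb'⟩
  have hanti := h'.antitoneOn_gaussianIntegral (Ioo_subset_Icc_self ht') x₀ (min_le_right b T : b' ≤ T)
  have hle := hanti hs' ht' hst
  dsimp only at hle
  -- identify both values of the (reference-`t`) Gaussian integral with Gaussian areas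
  rw [h'.gaussianIntegral_eq_integral (Ioo_subset_Icc_self ht') (Ioo_subset_Icc_self ht') x₀ T,
    h'.gaussianIntegral_eq_integral (Ioo_subset_Icc_self hs') (Ioo_subset_Icc_self ht') x₀ T] at hle
  have hτt : T - t = t₀ := by simp only [hT]; ring
  have hτs : T - s = t₀ + (t - s) := by simp only [hT]; ring
  rw [hτt, hτs] at hle
  rw [h.gaussianArea_image_eq (Ioo_subset_Icc_self ht) x₀ ht₀,
    h.gaussianArea_image_eq (Ioo_subset_Icc_self hs) x₀ (by linarith : 0 < t₀ + (t - s))]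
  exact ENNReal.ofReal_le_ofReal hle

/-- **The Colding–Minicozzi entropy is non-increasing along a classical mean curvature flow**
(Colding–Minicozzi 2012, Lemma 1.11 / (1.9): the entropy `λ(M_t)` is non-increasing under the
flow): for `a < s ≤ t < b`, `λ(F_t(N)) ≤ λ(F_s(N))`. [cite: ColdingMinicozzi2012, Lemma 1.11]
[cite: Huisken1990, Thm. 3.1] -/
theorem IsClassicalMCF.gaussianEntropy_image_le
    (h : IsClassicalMCF (euclideanMetric (EuclideanSpace ℝ (Fin (n + 1)))) F ν a b) {s t : ℝ}
    (hs : s ∈ Ioo a b) (ht : t ∈ Ioo a b) (hst : s ≤ t) :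
    gaussianEntropy n (F t '' univ) ≤ gaussianEntropy n (F s '' univ) := by
  rw [gaussianEntropy, measureGaussianEntropy]
  refine iSup_le fun p ↦ iSup_le fun t₀ ↦ iSup_le fun ht₀ ↦ ?_
  calc gaussianMass n p t₀ ((μHE[n] : Measure (EuclideanSpace ℝ (Fin (n + 1)))).restrict (F t '' univ))
      = gaussianArea n p t₀ (F t '' univ) := rfl
    _ ≤ gaussianArea n p (t₀ + (t - s)) (F s '' univ) := h.gaussianArea_image_le hs ht hst p ht₀
    _ ≤ gaussianEntropy n (F s '' univ) :=
        gaussianArea_le_gaussianEntropy n p (by linarith) _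

end EntropyMonotonicity

/-! ### The closed time interval: continuity, monotonicity from the initial slice -/

section Continuity

variable {n : ℕ} {N : Type*} [TopologicalSpace N] [ChartedSpace (EuclideanSpace ℝ (Fin n)) N]
  [IsManifold (𝓡 n) ∞ N] [CompactSpace N] [T2Space N] [MeasurableSpace N] [BorelSpace N]
  {F : ℝ → N → EuclideanSpace ℝ (Fin (n + 1))}
  {ν : (t : ℝ) → NormalField (𝓡 (n + 1)) (F t)} {a b : ℝ}

/-- **Continuity of `t ↦ ∫ f(t, ·) θ_t dμ_{t₀}` on the closed interval** `[a, b]` for `f` jointly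
continuous on `[a, b] × N` (dominated convergence: `θ_t` is continuous in `t`, non-increasing,
hence bounded by `max θ_a` on `[a, b]`). Companion of `hasDerivAt_integral_mul_density` giving the
one-sided information at the endpoints. [cite: Mantegazza2011, Prop. 2.3.3] -/
theorem IsClassicalMCF.continuousOn_integral_mul_density
    (h : IsClassicalMCF (euclideanMetric (EuclideanSpace ℝ (Fin (n + 1)))) F ν a b) {t₀ : ℝ}
    (ht₀ : t₀ ∈ Icc a b) {f : ℝ → N → ℝ} (hfc : ContinuousOn (uncurry f) (Icc a b ×ˢ univ)) :
    ContinuousOn (fun t ↦ ∫ w, f t w *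
        (Real.sqrt (Matrix.of fun i j ↦
          (euclideanMetric (EuclideanSpace ℝ (Fin (n + 1)))).inducedBilin (𝓡 n) (F t) w
            ((trivializationAt (EuclideanSpace ℝ (Fin n)) (TangentSpace (𝓡 n)) w).localFrame
              (EuclideanSpace.basisFun (Fin n) ℝ).toBasis i w)
            ((trivializationAt (EuclideanSpace ℝ (Fin n)) (TangentSpace (𝓡 n)) w).localFrame
              (EuclideanSpace.basisFun (Fin n) ℝ).toBasis j w)).det /
         Real.sqrt (Matrix.of fun i j ↦
          (euclideanMetric (EuclideanSpace ℝ (Fin (n + 1)))).inducedBilin (𝓡 n) (F t₀) w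
            ((trivializationAt (EuclideanSpace ℝ (Fin n)) (TangentSpace (𝓡 n)) w).localFrame
              (EuclideanSpace.basisFun (Fin n) ℝ).toBasis i w)
            ((trivializationAt (EuclideanSpace ℝ (Fin n)) (TangentSpace (𝓡 n)) w).localFrame
              (EuclideanSpace.basisFun (Fin n) ℝ).toBasis j w)).det)
        ∂riemannianMeasure ((euclideanMetric (EuclideanSpace ℝ (Fin (n + 1)))).inducedRiemannianMetric
          (F t₀) contMDiff_pullbackBilin_holds (h.isSpacelikeImmersion t₀ ht₀))) (Icc a b) := by
  -- the densities (as in `hasDerivAt_integral_mul_density`)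
  set g : ∀ t, t ∈ Icc a b → ContMDiffRiemannianMetric (𝓡 n) ∞ (EuclideanSpace ℝ (Fin n))
      (TangentSpace (𝓡 n) : N → Type _) := fun t ht ↦
    (euclideanMetric (EuclideanSpace ℝ (Fin (n + 1)))).inducedRiemannianMetric (F t)
      contMDiff_pullbackBilin_holds (h.isSpacelikeImmersion t ht) with hg
  set μ₀ := riemannianMeasure (g t₀ ht₀) with hμ₀
  haveI : IsFiniteMeasure μ₀ := isFiniteMeasure_riemannianMeasure _
  set D : ℝ → N → ℝ := fun t w ↦ (Matrix.of fun i j ↦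
    (euclideanMetric (EuclideanSpace ℝ (Fin (n + 1)))).inducedBilin (𝓡 n) (F t) w
      ((trivializationAt (EuclideanSpace ℝ (Fin n)) (TangentSpace (𝓡 n)) w).localFrame
        (EuclideanSpace.basisFun (Fin n) ℝ).toBasis i w)
      ((trivializationAt (EuclideanSpace ℝ (Fin n)) (TangentSpace (𝓡 n)) w).localFrame
        (EuclideanSpace.basisFun (Fin n) ℝ).toBasis j w)).det with hD
  set θ : ℝ → N → ℝ := fun t w ↦ Real.sqrt (D t w) / Real.sqrt (D t₀ w) with hθ
  have hDchart : ∀ t (ht : t ∈ Icc a b) w,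
      chartGramMatrix (g t ht) w (extChartAt (𝓡 n) w w) = Matrix.of fun i j ↦
        (euclideanMetric (EuclideanSpace ℝ (Fin (n + 1)))).inducedBilin (𝓡 n) (F t) w
          ((trivializationAt (EuclideanSpace ℝ (Fin n)) (TangentSpace (𝓡 n)) w).localFrame
            (EuclideanSpace.basisFun (Fin n) ℝ).toBasis i w)
          ((trivializationAt (EuclideanSpace ℝ (Fin n)) (TangentSpace (𝓡 n)) w).localFrame
            (EuclideanSpace.basisFun (Fin n) ℝ).toBasis j w) :=
    fun t ht w ↦ chartGramMatrix_inducedRiemannianMetric_self (h.isSpacelikeImmersion t ht) w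
  have hDpos : ∀ t (ht : t ∈ Icc a b) w, 0 < Real.sqrt (D t w) := fun t ht w ↦ by
    have := sqrt_det_chartGramMatrix_pos (g t ht) w (mem_extChartAt_target w)
    rwa [hDchart t ht w] at this
  have hθcan : ∀ t (ht : t ∈ Icc a b), θ t = fun w ↦
      Real.sqrt (chartGramMatrix (g t ht) w (extChartAt (𝓡 n) w w)).det /
        Real.sqrt (chartGramMatrix (g t₀ ht₀) w (extChartAt (𝓡 n) w w)).det := fun t ht ↦ by
    funext w
    simp only [hθ, hD, hDchart t ht w, hDchart t₀ ht₀ w]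
  have hθcont : ∀ t (ht : t ∈ Icc a b), Continuous (θ t) := fun t ht ↦ by
    rw [hθcan t ht]
    exact continuous_sqrt_det_chartGramMatrix_div (g t ht) (g t₀ ht₀)
  have hθpos : ∀ t (ht : t ∈ Icc a b) w, 0 < θ t w := fun t ht w ↦
    div_pos (hDpos t ht w) (hDpos t₀ ht₀ w)
  have hθd : ∀ t (ht : t ∈ Icc a b) w, HasDerivAt (fun s ↦ θ s w)
      (-((euclideanMetric _).meanCurvature (F t) contMDiff_pullbackBilin_holds
          (h.isSpacelikeImmersion t ht) (ν t) w) ^ 2 * θ t w) t := fun t ht w ↦ by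
    have hd := (h.hasDerivAt_sqrt_det_gram_localFrame ht w).div_const (Real.sqrt (D t₀ w))
    simp only [hθ]
    refine hd.congr_deriv ?_
    simp only [hD]
    ring
  -- `θ` is non-increasing in `t`, hence bounded by `max θ_a` on `[a, b]`
  have ha : a ∈ Icc a b := ⟨le_rfl, ht₀.1.trans ht₀.2⟩
  obtain ⟨M, hM⟩ := (isCompact_univ (X := N)).exists_bound_of_continuousOn (hθcont a ha).continuousOn
  have hθanti : ∀ w, AntitoneOn (fun s ↦ θ s w) (Icc a b) := fun w ↦ by
    refine antitoneOn_of_hasDerivWithinAt_nonpos (convex_Icc a b)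
      (f' := fun t ↦ if ht : t ∈ Icc a b then -((euclideanMetric _).meanCurvature (F t)
        contMDiff_pullbackBilin_holds (h.isSpacelikeImmersion t ht) (ν t) w) ^ 2 * θ t w else 0)
      (fun t ht ↦ (hθd t ht w).continuousAt.continuousWithinAt)
      (fun t ht ↦ ?_) fun t ht ↦ ?_
    · have ht' : t ∈ Icc a b := interior_subset ht
      simp only [dif_pos ht']
      exact (hθd t ht' w).hasDerivWithinAt
    · have ht' : t ∈ Icc a b := interior_subset ht
      simp only [dif_pos ht']
      have := hθpos t ht' w
      nlinarith [sq_nonneg ((euclideanMetric _).meanCurvature (F t) contMDiff_pullbackBilin_holds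
        (h.isSpacelikeImmersion t ht') (ν t) w)]
  have hθle : ∀ t ∈ Icc a b, ∀ w, θ t w ≤ M := fun t ht w ↦ by
    have h1 : θ t w ≤ θ a w := hθanti w ha ht ht.1
    have h2 : θ a w ≤ M := by
      have := hM w (mem_univ w)
      rw [Real.norm_eq_abs] at this
      exact (le_abs_self _).trans this
    exact h1.trans h2
  -- the bound on `f`
  have hK : IsCompact (Icc a b ×ˢ (univ : Set N)) := isCompact_Icc.prod isCompact_univ
  obtain ⟨C, hC⟩ := hK.exists_bound_of_continuousOn hfc
  have hcontt : ∀ t ∈ Icc a b, Continuous (f t) := fun t ht ↦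
    hfc.comp_continuous (continuous_const.prodMk continuous_id) fun y ↦ ⟨ht, mem_univ _⟩
  clear_value θ D
  -- dominated convergence, for the `θ`-form
  have key : ContinuousOn (fun t ↦ ∫ w, f t w * θ t w ∂μ₀) (Icc a b) := by
    refine continuousOn_of_dominated (bound := fun _ ↦ C * M) (fun t ht ↦
      ((hcontt t ht).mul (hθcont t ht)).aestronglyMeasurable) (fun t ht ↦
        Eventually.of_forall fun w ↦ ?_) (integrable_const _) (Eventually.of_forall fun w ↦ ?_)
    · have h0 := hC (t, w) ⟨ht, mem_univ _⟩
      simp only [uncurry_apply_pair, Real.norm_eq_abs] at h0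
      rw [Real.norm_eq_abs, abs_mul, abs_of_nonneg (hθpos t ht w).le]
      exact mul_le_mul h0 (hθle t ht w) (hθpos t ht w).le ((abs_nonneg _).trans h0)
    · -- continuity in `t` of `f t w θ t w` on `[a, b]`
      have hft : ContinuousOn (fun t ↦ f t w) (Icc a b) :=
        hfc.comp (continuous_id.prodMk continuous_const).continuousOn fun t ht ↦ ⟨ht, mem_univ _⟩
      exact hft.mul fun t ht ↦ (hθd t ht w).continuousAt.continuousWithinAt
  simp only [hθ, hD] at key
  exact key

end Continuity

section GaussianIntegralIcc

variable {n : ℕ} {N : Type*} [TopologicalSpace N] [ChartedSpace (EuclideanSpace ℝ (Fin n)) N]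
  [IsManifold (𝓡 n) ∞ N] [CompactSpace N] [T2Space N] [MeasurableSpace N] [BorelSpace N]
  {F : ℝ → N → EuclideanSpace ℝ (Fin (n + 1))}
  {ν : (t : ℝ) → NormalField (𝓡 (n + 1)) (F t)} {a b : ℝ}

omit [CompactSpace N] [T2Space N] [MeasurableSpace N] [BorelSpace N] in
/-- The kernel `ρ(F_t w, t)` is jointly continuous on `[a, b] × N` when `T > b`. [folklore] -/
theorem IsClassicalMCF.continuousOn_huiskenKernel_comp
    (h : IsClassicalMCF (euclideanMetric (EuclideanSpace ℝ (Fin (n + 1)))) F ν a b)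
    (x₀ : EuclideanSpace ℝ (Fin (n + 1))) {T : ℝ} (hT : b < T) :
    ContinuousOn (uncurry fun t w ↦ (4 * Real.pi * (T - t)) ^ (-(n : ℝ) / 2) *
      Real.exp (-‖F t w - x₀‖ ^ 2 / (4 * (T - t)))) (Icc a b ×ˢ univ) := by
  obtain ⟨U, hU, hIU, hF⟩ := h.contMDiffOn
  have hFc : ContinuousOn (fun q : ℝ × N ↦ F q.1 q.2) (Icc a b ×ˢ univ) :=
    hF.continuousOn.mono (Set.prod_mono hIU subset_rfl)
  have hτc : ContinuousOn (fun q : ℝ × N ↦ T - q.1) (Icc a b ×ˢ univ) :=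
    (continuous_const.sub continuous_fst).continuousOn
  have hτ0 : ∀ q ∈ Icc a b ×ˢ (univ : Set N), 0 < T - q.1 := fun q hq ↦ by
    have := hq.1.2; linarith
  refine ContinuousOn.mul ?_ ?_
  · exact ((continuousOn_const.mul hτc).rpow_const fun q hq ↦ Or.inl
      (mul_pos (mul_pos four_pos Real.pi_pos) (hτ0 q hq)).ne')
  · refine (ContinuousOn.div ?_ (continuousOn_const.mul hτc) fun q hq ↦ ?_).rexp
    · exact ((hFc.sub continuousOn_const).norm.pow 2).neg
    · exact (mul_pos four_pos (hτ0 q hq)).ne'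

/-- **Huisken's monotonicity on the closed interval**: for `T > b` the Gaussian integral (reference
measure `μ_r`, `r ∈ [a, b]`) is continuous and non-increasing on `[a, b]`.
[cite: Huisken1990, Thm. 3.1] -/
theorem IsClassicalMCF.antitoneOn_gaussianIntegral_Icc
    (h : IsClassicalMCF (euclideanMetric (EuclideanSpace ℝ (Fin (n + 1)))) F ν a b) {r : ℝ}
    (hr : r ∈ Icc a b) (x₀ : EuclideanSpace ℝ (Fin (n + 1))) {T : ℝ} (hT : b < T) :
    AntitoneOn (fun t ↦ ∫ w, ((4 * Real.pi * (T - t)) ^ (-(n : ℝ) / 2) *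
          Real.exp (-‖F t w - x₀‖ ^ 2 / (4 * (T - t)))) *
        (Real.sqrt (Matrix.of fun i j ↦
          (euclideanMetric (EuclideanSpace ℝ (Fin (n + 1)))).inducedBilin (𝓡 n) (F t) w
            ((trivializationAt (EuclideanSpace ℝ (Fin n)) (TangentSpace (𝓡 n)) w).localFrame
              (EuclideanSpace.basisFun (Fin n) ℝ).toBasis i w)
            ((trivializationAt (EuclideanSpace ℝ (Fin n)) (TangentSpace (𝓡 n)) w).localFrame
              (EuclideanSpace.basisFun (Fin n) ℝ).toBasis j w)).det /
         Real.sqrt (Matrix.of fun i j ↦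
          (euclideanMetric (EuclideanSpace ℝ (Fin (n + 1)))).inducedBilin (𝓡 n) (F r) w
            ((trivializationAt (EuclideanSpace ℝ (Fin n)) (TangentSpace (𝓡 n)) w).localFrame
              (EuclideanSpace.basisFun (Fin n) ℝ).toBasis i w)
            ((trivializationAt (EuclideanSpace ℝ (Fin n)) (TangentSpace (𝓡 n)) w).localFrame
              (EuclideanSpace.basisFun (Fin n) ℝ).toBasis j w)).det)
        ∂riemannianMeasure ((euclideanMetric (EuclideanSpace ℝ (Fin (n + 1)))).inducedRiemannianMetric
          (F r) contMDiff_pullbackBilin_holds (h.isSpacelikeImmersion r hr))) (Icc a b) := by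
  have hcont := h.continuousOn_integral_mul_density hr (h.continuousOn_huiskenKernel_comp x₀ hT)
  have hderiv : ∀ t₁ ∈ Ioo a b, ∃ D ≤ (0 : ℝ), HasDerivAt (fun t ↦ ∫ w, ((4 * Real.pi * (T - t)) ^ (-(n : ℝ) / 2) *
          Real.exp (-‖F t w - x₀‖ ^ 2 / (4 * (T - t)))) *
        (Real.sqrt (Matrix.of fun i j ↦
          (euclideanMetric (EuclideanSpace ℝ (Fin (n + 1)))).inducedBilin (𝓡 n) (F t) w
            ((trivializationAt (EuclideanSpace ℝ (Fin n)) (TangentSpace (𝓡 n)) w).localFrame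
              (EuclideanSpace.basisFun (Fin n) ℝ).toBasis i w)
            ((trivializationAt (EuclideanSpace ℝ (Fin n)) (TangentSpace (𝓡 n)) w).localFrame
              (EuclideanSpace.basisFun (Fin n) ℝ).toBasis j w)).det /
         Real.sqrt (Matrix.of fun i j ↦
          (euclideanMetric (EuclideanSpace ℝ (Fin (n + 1)))).inducedBilin (𝓡 n) (F r) w
            ((trivializationAt (EuclideanSpace ℝ (Fin n)) (TangentSpace (𝓡 n)) w).localFrame
              (EuclideanSpace.basisFun (Fin n) ℝ).toBasis i w)
            ((trivializationAt (EuclideanSpace ℝ (Fin n)) (TangentSpace (𝓡 n)) w).localFrame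
              (EuclideanSpace.basisFun (Fin n) ℝ).toBasis j w)).det)
        ∂riemannianMeasure ((euclideanMetric (EuclideanSpace ℝ (Fin (n + 1)))).inducedRiemannianMetric
          (F r) contMDiff_pullbackBilin_holds (h.isSpacelikeImmersion r hr))) D t₁ := by
    intro t₁ ht₁
    refine ⟨_, ?_, (h.hasDerivAt_gaussianIntegral ht₁ x₀ hT.le).congr_of_eventuallyEq ?_⟩
    · have hτ : 0 < T - t₁ := by linarith [ht₁.2]
      rw [neg_nonpos]
      refine integral_nonneg fun w ↦ ?_
      exact mul_nonneg (mul_nonneg (Real.rpow_nonneg (by positivity) _) (Real.exp_pos _).le)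
        (sq_nonneg _)
    · filter_upwards [isOpen_Ioo.mem_nhds ht₁] with t ht
      rw [h.gaussianIntegral_eq_integral (Ioo_subset_Icc_self ht) hr x₀ T,
        h.gaussianIntegral_eq_integral (Ioo_subset_Icc_self ht) (Ioo_subset_Icc_self ht₁) x₀ T]
  classical
  set D : ℝ → ℝ := fun t ↦ if ht : t ∈ Ioo a b then (hderiv t ht).choose else 0 with hD
  refine antitoneOn_of_hasDerivWithinAt_nonpos (convex_Icc a b) (f' := D) hcont
    (fun t ht ↦ ?_) (fun t ht ↦ ?_)
  · rw [interior_Icc] at ht ⊢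
    obtain ⟨_, hd⟩ := (hderiv t ht).choose_spec
    have hDt : D t = (hderiv t ht).choose := by simp only [hD, dif_pos ht]
    rw [hDt]
    exact hd.hasDerivWithinAt
  · rw [interior_Icc] at ht
    obtain ⟨hle, -⟩ := (hderiv t ht).choose_spec
    have hDt : D t = (hderiv t ht).choose := by simp only [hD, dif_pos ht]
    rw [hDt]
    exact hle

/-- **`F_{x₀,t₀}(M_t) ≤ F_{x₀,t₀+(t-s)}(M_s)` including the initial slice**: `a ≤ s ≤ t < b`,
`t₀ > 0`. [cite: ColdingMinicozzi2012, (1.9)] [cite: Huisken1990, Thm. 3.1] -/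
theorem IsClassicalMCF.gaussianArea_image_le_of_le
    (h : IsClassicalMCF (euclideanMetric (EuclideanSpace ℝ (Fin (n + 1)))) F ν a b) {s t : ℝ}
    (hs : s ∈ Icc a b) (ht : t ∈ Ico a b) (hst : s ≤ t) (x₀ : EuclideanSpace ℝ (Fin (n + 1)))
    {t₀ : ℝ} (ht₀ : 0 < t₀) :
    gaussianArea n x₀ t₀ (F t '' univ) ≤ gaussianArea n x₀ (t₀ + (t - s)) (F s '' univ) := by
  set T : ℝ := t + t₀ with hT
  have htm : t < min b T := lt_min ht.2 (by linarith)
  set b' : ℝ := (t + min b T) / 2 with hb'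
  have htb' : t < b' := by rw [hb']; linarith
  have hb'b : b' ≤ b := by
    rw [hb']; linarith [min_le_left b T]
  have hb'T : b' < T := by
    rw [hb']; linarith [min_le_right b T]
  have h' := h.restrict le_rfl hb'b
  have hs' : s ∈ Icc a b' := ⟨hs.1, hst.trans htb'.le⟩
  have ht' : t ∈ Icc a b' := ⟨ht.1, htb'.le⟩
  have hanti := h'.antitoneOn_gaussianIntegral_Icc ht' x₀ hb'T
  have hle := hanti hs' ht' hst
  dsimp only at hle
  rw [h'.gaussianIntegral_eq_integral ht' ht' x₀ T, h'.gaussianIntegral_eq_integral hs' ht' x₀ T] at hle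
  have hτt : T - t = t₀ := by simp only [hT]; ring
  have hτs : T - s = t₀ + (t - s) := by simp only [hT]; ring
  rw [hτt, hτs] at hle
  rw [h.gaussianArea_image_eq (Ico_subset_Icc_self ht) x₀ ht₀,
    h.gaussianArea_image_eq hs x₀ (by linarith : 0 < t₀ + (t - s))]
  exact ENNReal.ofReal_le_ofReal hle

/-- **The entropy is non-increasing from the initial slice on**: `λ(M_t) ≤ λ(M_s)` for
`a ≤ s ≤ t < b`; in particular `λ(M_t) ≤ λ(M_a)` for all `t ∈ [a, b)`.
[cite: ColdingMinicozzi2012, Lemma 1.11] -/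
theorem IsClassicalMCF.gaussianEntropy_image_le_of_le
    (h : IsClassicalMCF (euclideanMetric (EuclideanSpace ℝ (Fin (n + 1)))) F ν a b) {s t : ℝ}
    (hs : s ∈ Icc a b) (ht : t ∈ Ico a b) (hst : s ≤ t) :
    gaussianEntropy n (F t '' univ) ≤ gaussianEntropy n (F s '' univ) := by
  rw [gaussianEntropy, measureGaussianEntropy]
  refine iSup_le fun p ↦ iSup_le fun t₀ ↦ iSup_le fun ht₀ ↦ ?_
  calc gaussianMass n p t₀ ((μHE[n] : Measure (EuclideanSpace ℝ (Fin (n + 1)))).restrict (F t '' univ))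
      = gaussianArea n p t₀ (F t '' univ) := rfl
    _ ≤ gaussianArea n p (t₀ + (t - s)) (F s '' univ) := h.gaussianArea_image_le_of_le hs ht hst p ht₀
    _ ≤ gaussianEntropy n (F s '' univ) :=
        gaussianArea_le_gaussianEntropy n p (by linarith) _

/-- **`λ(M_t) ≤ λ(M_a)`**: along a classical mean curvature flow the entropy never exceeds that of
the initial hypersurface. [cite: ColdingMinicozzi2012, Lemma 1.11] -/
theorem IsClassicalMCF.gaussianEntropy_image_le_initial
    (h : IsClassicalMCF (euclideanMetric (EuclideanSpace ℝ (Fin (n + 1)))) F ν a b) {t : ℝ}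
    (ht : t ∈ Ico a b) :
    gaussianEntropy n (F t '' univ) ≤ gaussianEntropy n (F a '' univ) :=
  h.gaussianEntropy_image_le_of_le ⟨le_rfl, ht.1.trans ht.2.le⟩ ht ht.1

end GaussianIntegralIcc

/-! ### Huisken's Gaussian density -/

section GaussianDensity

variable {n : ℕ} {N : Type*} [TopologicalSpace N] [ChartedSpace (EuclideanSpace ℝ (Fin n)) N]
  [IsManifold (𝓡 n) ∞ N] [CompactSpace N] [T2Space N] [MeasurableSpace N] [BorelSpace N]
  {F : ℝ → N → EuclideanSpace ℝ (Fin (n + 1))}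
  {ν : (t : ℝ) → NormalField (𝓡 (n + 1)) (F t)} {a b : ℝ}

/-- **`t ↦ F_{x₀, T-t}(M_t)` is non-increasing on `(a, T)`** for `T ≤ b` (Huisken's monotonicity
in the `F`-functional, `gaussianArea_image_le`). [cite: ColdingMinicozzi2012, (1.9)]
[cite: Huisken1990, Thm. 3.1] -/
theorem IsClassicalMCF.antitoneOn_gaussianArea_image
    (h : IsClassicalMCF (euclideanMetric (EuclideanSpace ℝ (Fin (n + 1)))) F ν a b)
    (x₀ : EuclideanSpace ℝ (Fin (n + 1))) {T : ℝ} (hT : T ≤ b) :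
    AntitoneOn (fun t ↦ gaussianArea n x₀ (T - t) (F t '' univ)) (Ioo a T) := by
  intro s hs t ht hst
  have hs' : s ∈ Ioo a b := ⟨hs.1, lt_of_lt_of_le hs.2 hT⟩
  have ht' : t ∈ Ioo a b := ⟨ht.1, lt_of_lt_of_le ht.2 hT⟩
  have key := h.gaussianArea_image_le hs' ht' hst x₀ (sub_pos.2 ht.2)
  dsimp only
  rwa [show T - t + (t - s) = T - s by ring] at key

/-- **Huisken's Gaussian density of a classical flow exists as a limit**: for `T ∈ (a, b]` and
`x₀ ∈ ℝⁿ⁺¹` the Gaussian integrals `F_{x₀,T-t}(M_t)` converge as `t ↑ T` (to their infimum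
`Θ(x₀, T)`, the Gaussian density), being non-increasing in `t`. [cite: Huisken1990, Thm. 3.1]
[cite: ColdingMinicozzi2012, (1.9)] -/
theorem IsClassicalMCF.tendsto_gaussianArea_image
    (h : IsClassicalMCF (euclideanMetric (EuclideanSpace ℝ (Fin (n + 1)))) F ν a b)
    (x₀ : EuclideanSpace ℝ (Fin (n + 1))) {T : ℝ} (hT : T ∈ Ioc a b) :
    Tendsto (fun t ↦ gaussianArea n x₀ (T - t) (F t '' univ)) (𝓝[<] T)
      (𝓝 (sInf ((fun t ↦ gaussianArea n x₀ (T - t) (F t '' univ)) '' Ioo a T))) :=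
  (h.antitoneOn_gaussianArea_image x₀ hT.2).tendsto_nhdsWithin_Ioo_left (nonempty_Ioo.2 hT.1)
    (OrderBot.bddBelow _)

/-- **The Gaussian density is bounded by the entropy of every earlier slice**, in particular by
that of the initial hypersurface: `Θ(x₀, T) ≤ F_{x₀,T-s}(M_s) ≤ λ(M_s) ≤ λ(M_a)` for
`s ∈ (a, T)`. [cite: ColdingMinicozzi2012, Lemma 1.11] -/
theorem IsClassicalMCF.gaussianDensity_le_gaussianEntropy
    (h : IsClassicalMCF (euclideanMetric (EuclideanSpace ℝ (Fin (n + 1)))) F ν a b)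
    (x₀ : EuclideanSpace ℝ (Fin (n + 1))) {T : ℝ} (hT : T ∈ Ioc a b) {s : ℝ} (hs : s ∈ Ioo a T) :
    sInf ((fun t ↦ gaussianArea n x₀ (T - t) (F t '' univ)) '' Ioo a T) ≤
      gaussianEntropy n (F s '' univ) ∧
    gaussianEntropy n (F s '' univ) ≤ gaussianEntropy n (F a '' univ) := by
  refine ⟨(sInf_le (mem_image_of_mem (fun t ↦ gaussianArea n x₀ (T - t) (F t '' univ)) hs)).trans
    (gaussianArea_le_gaussianEntropy n x₀ (sub_pos.2 hs.2) _), ?_⟩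
  exact h.gaussianEntropy_image_le_initial ⟨hs.1.le, lt_of_lt_of_le hs.2 hT.2⟩

end GaussianDensity

/-! ### The area of the slices is non-increasing -/

section AreaMonotone

variable {n : ℕ} {N : Type*} [TopologicalSpace N] [ChartedSpace (EuclideanSpace ℝ (Fin n)) N]
  [IsManifold (𝓡 n) ∞ N] [CompactSpace N] [T2Space N] [MeasurableSpace N] [BorelSpace N]
  {F : ℝ → N → EuclideanSpace ℝ (Fin (n + 1))}
  {ν : (t : ℝ) → NormalField (𝓡 (n + 1)) (F t)} {a b : ℝ}

/-- **The area of the slices, as the density integral**: for `t, r ∈ [a, b]`,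
`𝓗ⁿ(M_t) = ENNReal.ofReal (∫_N θ^{r}_t dμ_r)` (`μ_t(N) = ∫ θ_t dμ_r`, `integral_riemannianMeasure_eq`
with `φ ≡ 1`, and `μ_t = 𝓗ⁿ ⌊ M_t` pulled back, `riemannianMeasure_induced_apply`).
[cite: Mantegazza2011, Prop. 2.3.3] -/
theorem IsClassicalMCF.hausdorffMeasure_image_eq
    (h : IsClassicalMCF (euclideanMetric (EuclideanSpace ℝ (Fin (n + 1)))) F ν a b) {t r : ℝ}
    (ht : t ∈ Icc a b) (hr : r ∈ Icc a b) :
    μHE[n] (F t '' univ) = ENNReal.ofReal (∫ w,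
        (Real.sqrt (Matrix.of fun i j ↦
          (euclideanMetric (EuclideanSpace ℝ (Fin (n + 1)))).inducedBilin (𝓡 n) (F t) w
            ((trivializationAt (EuclideanSpace ℝ (Fin n)) (TangentSpace (𝓡 n)) w).localFrame
              (EuclideanSpace.basisFun (Fin n) ℝ).toBasis i w)
            ((trivializationAt (EuclideanSpace ℝ (Fin n)) (TangentSpace (𝓡 n)) w).localFrame
              (EuclideanSpace.basisFun (Fin n) ℝ).toBasis j w)).det /
         Real.sqrt (Matrix.of fun i j ↦
          (euclideanMetric (EuclideanSpace ℝ (Fin (n + 1)))).inducedBilin (𝓡 n) (F r) w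
            ((trivializationAt (EuclideanSpace ℝ (Fin n)) (TangentSpace (𝓡 n)) w).localFrame
              (EuclideanSpace.basisFun (Fin n) ℝ).toBasis i w)
            ((trivializationAt (EuclideanSpace ℝ (Fin n)) (TangentSpace (𝓡 n)) w).localFrame
              (EuclideanSpace.basisFun (Fin n) ℝ).toBasis j w)).det)
      ∂riemannianMeasure ((euclideanMetric (EuclideanSpace ℝ (Fin (n + 1)))).inducedRiemannianMetric
        (F r) contMDiff_pullbackBilin_holds (h.isSpacelikeImmersion r hr))) := by
  have hsp := h.isSpacelikeImmersion t ht
  set μt := riemannianMeasure ((euclideanMetric (EuclideanSpace ℝ (Fin (n + 1)))).inducedRiemannianMetric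
    (F t) contMDiff_pullbackBilin_holds hsp) with hμt
  haveI : IsFiniteMeasure μt := isFiniteMeasure_riemannianMeasure _
  rw [← riemannianMeasure_induced_apply hsp (h.injective t ht) MeasurableSet.univ]
  have h1 := h.integral_riemannianMeasure_eq ht hr (fun _ ↦ (1 : ℝ))
  simp only [smul_eq_mul, mul_one, integral_const, smul_eq_mul, mul_one] at h1
  -- `μ_t(univ).toReal = ∫ θ dμ_r`
  rw [← h1, Measure.real, ENNReal.ofReal_toReal (measure_ne_top _ _)]

/-- **The area of a hypersurface moving by mean curvature is non-increasing** (on the whole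
closed interval): `𝓗ⁿ(M_t) ≤ 𝓗ⁿ(M_s)` for `a ≤ s ≤ t ≤ b` (`d/dt Area = -∫H² ≤ 0` in the
interior, continuity at the endpoints). [cite: Huisken1984, §3] [cite: Mantegazza2011, Cor. 2.3.4] -/
theorem IsClassicalMCF.hausdorffMeasure_image_le
    (h : IsClassicalMCF (euclideanMetric (EuclideanSpace ℝ (Fin (n + 1)))) F ν a b) {s t : ℝ}
    (hs : s ∈ Icc a b) (ht : t ∈ Icc a b) (hst : s ≤ t) :
    μHE[n] (F t '' univ) ≤ μHE[n] (F s '' univ) := by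
  have ha : a ∈ Icc a b := ⟨le_rfl, hs.1.trans hs.2⟩
  -- the area written against `μ_a` is continuous on `[a, b]` and has derivative `≤ 0` inside
  set A : ℝ → ℝ := fun t ↦ ∫ w,
        (Real.sqrt (Matrix.of fun i j ↦
          (euclideanMetric (EuclideanSpace ℝ (Fin (n + 1)))).inducedBilin (𝓡 n) (F t) w
            ((trivializationAt (EuclideanSpace ℝ (Fin n)) (TangentSpace (𝓡 n)) w).localFrame
              (EuclideanSpace.basisFun (Fin n) ℝ).toBasis i w)
            ((trivializationAt (EuclideanSpace ℝ (Fin n)) (TangentSpace (𝓡 n)) w).localFrame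
              (EuclideanSpace.basisFun (Fin n) ℝ).toBasis j w)).det /
         Real.sqrt (Matrix.of fun i j ↦
          (euclideanMetric (EuclideanSpace ℝ (Fin (n + 1)))).inducedBilin (𝓡 n) (F a) w
            ((trivializationAt (EuclideanSpace ℝ (Fin n)) (TangentSpace (𝓡 n)) w).localFrame
              (EuclideanSpace.basisFun (Fin n) ℝ).toBasis i w)
            ((trivializationAt (EuclideanSpace ℝ (Fin n)) (TangentSpace (𝓡 n)) w).localFrame
              (EuclideanSpace.basisFun (Fin n) ℝ).toBasis j w)).det)
      ∂riemannianMeasure ((euclideanMetric (EuclideanSpace ℝ (Fin (n + 1)))).inducedRiemannianMetric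
        (F a) contMDiff_pullbackBilin_holds (h.isSpacelikeImmersion a ha)) with hA
  have hcont : ContinuousOn A (Icc a b) := by
    have hc := h.continuousOn_integral_mul_density ha (f := fun _ _ ↦ (1 : ℝ)) continuousOn_const
    simp only [one_mul] at hc
    exact hc
  -- derivative in the interior: reference independence + `hasDerivAt_area`
  have hderiv : ∀ t₁ ∈ Ioo a b, ∃ D ≤ (0 : ℝ), HasDerivAt A D t₁ := by
    intro t₁ ht₁
    refine ⟨_, ?_, (h.hasDerivAt_area ht₁).congr_of_eventuallyEq ?_⟩
    · rw [neg_nonpos]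
      exact integral_nonneg fun w ↦ sq_nonneg _
    · filter_upwards [isOpen_Ioo.mem_nhds ht₁] with t' ht'
      have e1 := h.integral_riemannianMeasure_eq (Ioo_subset_Icc_self ht') ha (fun _ ↦ (1 : ℝ))
      have e2 := h.integral_riemannianMeasure_eq (Ioo_subset_Icc_self ht') (Ioo_subset_Icc_self ht₁)
        (fun _ ↦ (1 : ℝ))
      simp only [smul_eq_mul, mul_one] at e1 e2
      simp only [hA]
      rw [← e1, ← e2]
  classical
  set D : ℝ → ℝ := fun t ↦ if ht : t ∈ Ioo a b then (hderiv t ht).choose else 0 with hD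
  have hanti : AntitoneOn A (Icc a b) := by
    refine antitoneOn_of_hasDerivWithinAt_nonpos (convex_Icc a b) (f' := D) hcont
      (fun t ht ↦ ?_) (fun t ht ↦ ?_)
    · rw [interior_Icc] at ht ⊢
      obtain ⟨_, hd⟩ := (hderiv t ht).choose_spec
      have hDt : D t = (hderiv t ht).choose := by simp only [hD, dif_pos ht]
      rw [hDt]
      exact hd.hasDerivWithinAt
    · rw [interior_Icc] at ht
      obtain ⟨hle, -⟩ := (hderiv t ht).choose_spec
      have hDt : D t = (hderiv t ht).choose := by simp only [hD, dif_pos ht]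
      rw [hDt]
      exact hle
  have hle := hanti hs ht hst
  rw [h.hausdorffMeasure_image_eq ht ha, h.hausdorffMeasure_image_eq hs ha]
  exact ENNReal.ofReal_le_ofReal hle

end AreaMonotone

/-! ### Uniform bounds along the flow from the initial entropy -/

section UniformAreaRatio

variable {n : ℕ} {N : Type*} [TopologicalSpace N] [ChartedSpace (EuclideanSpace ℝ (Fin n)) N]
  [IsManifold (𝓡 n) ∞ N] [CompactSpace N] [T2Space N] [MeasurableSpace N] [BorelSpace N]
  {F : ℝ → N → EuclideanSpace ℝ (Fin (n + 1))}
  {ν : (t : ℝ) → NormalField (𝓡 (n + 1)) (F t)} {a b : ℝ}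

/-- **Every Gaussian area of every slice is bounded by the initial entropy**:
`F_{x₀,t₀}(M_t) ≤ λ(M_a)` for `t ∈ [a, b)`, `t₀ > 0`. [cite: ColdingMinicozzi2012, Lemma 1.11] -/
theorem IsClassicalMCF.gaussianArea_image_le_gaussianEntropy_initial
    (h : IsClassicalMCF (euclideanMetric (EuclideanSpace ℝ (Fin (n + 1)))) F ν a b) {t : ℝ}
    (ht : t ∈ Ico a b) (x₀ : EuclideanSpace ℝ (Fin (n + 1))) {t₀ : ℝ} (ht₀ : 0 < t₀) :
    gaussianArea n x₀ t₀ (F t '' univ) ≤ gaussianEntropy n (F a '' univ) :=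
  (gaussianArea_le_gaussianEntropy n x₀ ht₀ _).trans (h.gaussianEntropy_image_le_initial ht)

/-- **Uniform area-ratio bounds along a classical mean curvature flow**: for `t ∈ [a, b)`,
`p ∈ ℝⁿ⁺¹` and `R > 0`,
`𝓗ⁿ(M_t ∩ B̄_R(p)) ≤ e^{1/4} (4π)^{n/2} Rⁿ · λ(M_a)` — the scale-invariant area bound from the
entropy (`measure_inter_closedBall_le_mul_gaussianEntropy`, `ColdingMinicozziEntropyAreaRatio.lean`)
combined with the monotonicity of the entropy (`gaussianEntropy_image_le_initial`). These are the
uniform local mass bounds used for compactness of (Brakke) flows.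
[cite: ColdingMinicozzi2012, Lemma 1.11 and (2.8)] -/
theorem IsClassicalMCF.measure_inter_closedBall_image_le
    (h : IsClassicalMCF (euclideanMetric (EuclideanSpace ℝ (Fin (n + 1)))) F ν a b) {t : ℝ}
    (ht : t ∈ Ico a b) (p : EuclideanSpace ℝ (Fin (n + 1))) {R : ℝ} (hR : 0 < R) :
    (μHE[n] : Measure (EuclideanSpace ℝ (Fin (n + 1)))) (F t '' univ ∩ closedBall p R) ≤
      ENNReal.ofReal (Real.exp (1 / 4) * (4 * Real.pi) ^ ((n : ℝ) / 2) * R ^ n) *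
        gaussianEntropy n (F a '' univ) :=
  (measure_inter_closedBall_le_mul_gaussianEntropy n (F t '' univ) p hR).trans <|
    mul_le_mul' le_rfl (h.gaussianEntropy_image_le_initial ht)

/-- **Uniform total-area bound**: `𝓗ⁿ(M_t) ≤ 𝓗ⁿ(M_a)` for all `t ∈ [a, b]` (area monotonicity,
`hausdorffMeasure_image_le`). [cite: Huisken1984, §3] -/
theorem IsClassicalMCF.hausdorffMeasure_image_le_initial
    (h : IsClassicalMCF (euclideanMetric (EuclideanSpace ℝ (Fin (n + 1)))) F ν a b) {t : ℝ}
    (ht : t ∈ Icc a b) :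
    μHE[n] (F t '' univ) ≤ μHE[n] (F a '' univ) :=
  h.hausdorffMeasure_image_le ⟨le_rfl, ht.1.trans ht.2⟩ ht ht.1

end UniformAreaRatio

end Literature.Geometry.Riemannian

end
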